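import Summits.BirchSwinnertonDyer.BirchSwinnertonDyer.Theorems.KolyvaginRoadThreeZhangSupplyJumpWeil
import Summits.BirchSwinnertonDyer.Rank1Residual.X11b.KummerRelaxedStructures
import Summits.BirchSwinnertonDyer.Rank1Residual.X11b.BDPRouteSelmerLevelBound
import Summits.BirchSwinnertonDyer.Rank1Residual.GaloisImage.LocalEulerPoincareCharacteristicHolds
import Literature.NumberTheory.GaloisRepresentations.ContinuousH1OrderTwo
import Literature.NumberTheory.EllipticCurves.CasselsTateLocalCupSymmetry
import HarnessLib

/-!
# Route `AdditiveKolyvaginRoad`, crux `LevelKolyvaginSystemsAdditive` (item stmt-BirchSwinnertonDyer-21396, KS′):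
# the Poitou–Tate JUMP at ONE relaxed finite place for ODD `p`, over ANY number field, EXACT index
# `[relaxed : strict]² = #H¹(K_w, E[p])` — step 1 of (T-A1p), the PT inputs AT THE PLACE `p` for the three-Lagrangian switch
# (cell `pub/bsd-wall`, width seat `bsd-wall-akr-p2x-w2` g3; `--supports stmt-BirchSwinnertonDyer-21396`, helper)

WHY. The transfer-type crux lines on KS′ (survivor A of TRIAGE-r1: `depleted-shadow-transfer` ⊕ `pold-fusion-glue` ⊕
`epsilon-matched-retyping`) glue a lender's level system to `E` along a congruence; their stub (A1) «the Kummer LINE of `E` at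
`p` equals the transported Kummer line of the lender» is decided by w3 g0's THREE-LAGRANGIAN SWITCH
(`Theorems/AdditiveKolyvaginRoadLagrangianSwitch.lean`, pure linear algebra) once its hypotheses are discharged AT THE PLACE `p`:
plane count, Lagrangian Kummer line, isotropy of the relaxed image (Poitou–Tate reciprocity) and the JUMP (Poitou–Tate count)
— item (T-A1p) of `Cruxes/LevelKolyvaginSystemsAdditive/SOCKETS-TRANSFER.md`, listed «not built» in `ESIDE-CLOSED.md` §2. By
TRIAGE-r1-1 §5 the switch must run over `ℚ` (one place above `p`; over the Heegner field `K` complex conjugation pairs the two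
places above the split `p` and the parity change is even), so REAL places must be allowed. This file is the jump, in the
generality «any number field, any finite place, odd `p`».

WHAT (namespace `…Theorems.AdditiveKoly.LagrangianSwitchAtP`; `W` an elliptic curve over a number field `K`).
* §1 `addSubgroup_inl_eq_top_of_odd` — at an infinite place every local condition on `E[n]` is everything for odd `n`
  (`H¹(K_w, E[n])` is killed by `2` and by `n`; tree `eq_zero_of_odd_nsmul_galoisCohomology_one_toLocal_inl`).
* §2 `annRight_kummer_eq_of_odd` — for an ODD prime power `n` and a perfect family `inv`, E's Kummer condition is its own right
  annihilator under `inv_v(· ∪ₑ ·)` at EVERY place (finite: X11b `KummerDuality.…_inr` + Tate's local Euler characteristic,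
  PROVED in the tree as `localEulerPoincareCharacteristic_holds`; infinite: both sides are `0`). X11b's
  `annRight_invWeilPairing_kummerSelmerStructure_eq` needs all infinite places complex; this variant trades that for `n` odd.
* §3 `relIndex_sq_eq_of_lagrangian` — for Selmer structures `𝓕 ≤ 𝓖` on `E[n]` that differ only at the finite place `w`
  (`0` resp. everything there) and whose common conditions are LAGRANGIAN off `w`: `[H¹_𝓖 : H¹_𝓕]² = #H¹(K_w, E[n])`
  (koly3b part XII's Weil-transport self-duality §1–§2 verbatim, then part XI's `relIndex_sq_eq_of_selfdual`; part XII had kept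
  only the corollary «image not inside a line»).
* §4 `relIndex_kummerStrict_kummerRelaxed_sq` — THE JUMP: for `p ≠ 2`, a Poitou–Tate family `inv` at level `p` (`IsPerfect`,
  `SumLocalTermEqZero`, `SelmerComplement` = the content of DUAL.2 `poitouTate_selmerStructure_duality K`) and ANY finite place
  `w₀` of ANY number field `K`: `[H¹_{𝓚 relaxed at w₀} : H¹_{𝓚 strict at w₀}]² = #H¹(K_{w₀}, E[p])` for the X11b structures
  `KummerPT.kummerRelaxed ∕ kummerStrict W p {w₀}`. At `w₀ ∣ p` with `#H¹(K_{w₀}, E[p]) = p²` (`E(K_{w₀})[p] = 0`,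
  `[K_{w₀} : ℚ_p] = 1`) this is the jump `[relaxed : strict] = p` consumed by the switch (sequel file). (akr-p2x g0's
  `exists_relaxed_notMem_torsionLocalKer_of_admQ` is the same count at an ADMISSIBLE place over an imaginary quadratic `K`.)

HONEST FRAMING: theorems only; 0 definitions, 0 named facts, 0 `sorry`; CONDITIONAL on the displayed Poitou–Tate family (the
route's DUAL.2) — nothing else; E-side glue; closes nothing. Levels are written `p ^ 1` to match the carrier's `Vp W K p`.
The crux's open content ((T-A2) transfer of Heegner classes, K1 at `p²`-level, the seed) is untouched. BSD is not proved by
any of this.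

References: [cite: PoonenRains2012, Prop. 4.10, Prop. 4.11] [cite: McCallumLMS1991, Prop. 2.1 (p. 296)] [cite: MilneADT2006, Ch. I,
Cor. 2.3, Thm. 2.8, Rem. 3.7, Cor. 3.4, Thm. 4.10, Lemma 6.15] [cite: Howard2004HeegnerKolyvagin, Def. 2.1.10, Thm. 2.1.11]
[cite: SerreGaloisCohomology1997, I §2.4].
-/

-- single-conjunct summit: `Summit.BirchSwinnertonDyer.BirchSwinnertonDyer.…` repeats the name by design
set_option linter.dupNamespace false

noncomputable section

open scoped Classical NumberField
open Function NumberField IsDedekindDomain Field WeierstrassCurve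
open Literature.NumberTheory.EllipticCurves
open Literature.NumberTheory.GaloisRepresentations Literature.NumberTheory.GaloisRepresentations.DiscreteGaloisModule
  Literature.NumberTheory.GaloisCohomology
open Summit.BirchSwinnertonDyer.Rank1Residual.X11b.FiniteDuality
open Summit.BirchSwinnertonDyer.Rank1Residual.X11b.Relaxation
open Summit.BirchSwinnertonDyer.Rank1Residual.X11b.LocBridge
open Summit.BirchSwinnertonDyer.Rank1Residual.X11b
open Summit.BirchSwinnertonDyer.Rank1Residual.GaloisImage
open Summit.BirchSwinnertonDyer.Rank1Residual.X11b.Three.Koly.ZhangSupply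
open Summit.BirchSwinnertonDyer.Rank1Residual.X11b.KummerPT

namespace Summit.BirchSwinnertonDyer.BirchSwinnertonDyer.Theorems.AdditiveKoly.LagrangianSwitchAtP

variable {K : Type} [Field K] [NumberField K] (W : WeierstrassCurve K) [W.IsElliptic]

/-! ## §1 Odd level: the archimedean places impose no condition -/

omit [W.IsElliptic] in
/-- **At an infinite place every local condition on `E[n]` is everything, `n` odd** (`H¹(K_w, E[n])` is killed by
`2 = #Γ_{K_w}` and by `n`). [cite: MilneADT2006, Ch. I, Rem. 3.7] [cite: SerreGaloisCohomology1997, I §2.4] -/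
theorem addSubgroup_inl_eq_top_of_odd (n : ℕ) (hodd : Odd n) (w : InfinitePlace K)
    (A : AddSubgroup (galoisCohomology ((W.torsionGaloisModule (n : ℤ)).toLocal (Sum.inl w : Place K)) 1)) :
    A = ⊤ := by
  have h0 : ∀ y : galoisCohomology ((W.torsionGaloisModule (n : ℤ)).toLocal (Sum.inl w : Place K)) 1, y = 0 :=
    fun y ↦ eq_zero_of_odd_nsmul_galoisCohomology_one_toLocal_inl _ w hodd y
      (nsmul_continuousCohomology_one_eq_zero _ n
        (fun T : W.geomTorsion (n : ℤ) ↦ AddSubgroup.torsionBy.nsmul T) y)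
  ext y
  rw [h0 y]
  exact ⟨fun _ ↦ AddSubgroup.mem_top _, fun _ ↦ A.zero_mem⟩


/-! ## §2 Odd prime-power level: E's Kummer condition is LAGRANGIAN at EVERY place of ANY number field -/

section Lagrangian

variable (n : ℕ) [NeZero n]
variable (e : W.geomTorsion n → W.geomTorsion n → AlgebraicClosure K)
  (hμ : ∀ S T, e S T ^ n = 1)
  (hadd₁ : ∀ S₁ S₂ T, e (S₁ + S₂) T = e S₁ T * e S₂ T)
  (hadd₂ : ∀ S T₁ T₂, e S (T₁ + T₂) = e S T₁ * e S T₂)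
  (hgal : ∀ (σ : absoluteGaloisGroup K) (S T : W.geomTorsion n), σ • e S T = e (σ • S) (σ • T))
  (halt : ∀ T, e T T = 1) (hnondeg : ∀ T, (∀ S, e S T = 1) → T = 0)
  (inv : LocalInvariants K n)

include halt hnondeg in
/-- **E's Kummer condition is its own right annihilator under `inv_v(· ∪ₑ ·)` at EVERY place**, for an ODD prime power
`n`, a perfect family `inv` and ANY number field `K` (real places allowed): at the finite places this is X11b's
`KummerDuality.annRight_invWeilPairing_kummerSelmerStructure_inr` fed with Tate's local Euler characteristic (PROVED in
the tree, `localEulerPoincareCharacteristic_holds`); at the infinite places both sides are the zero group `H¹(K_w, E[n]) = 0`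
(`n` odd). The tree's `annRight_invWeilPairing_kummerSelmerStructure_eq` asks all infinite places to be complex instead.
[cite: MilneADT2006, Ch. I, Cor. 3.4, Thm. 2.8, Rem. 3.7] [cite: PoonenRains2012, Prop. 4.10] -/
theorem annRight_kummer_eq_of_odd
    -- cup products need the compactness of the local absolute Galois groups (binder, discharged by
    -- `absoluteGaloisGroup_compactSpace` at the call site)
    [∀ v : Place K, CompactSpace (absoluteGaloisGroup (Place.Completion v))] [Finite (W.geomTorsion n)]
    (hn : IsPrimePow n) (hodd : Odd n) (hperf : inv.IsPerfect) (v : Place K) :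
    annRight (invWeilPairing W n e hμ hadd₁ hadd₂ hgal inv v) (W.kummerSelmerStructure n v) =
      W.kummerSelmerStructure n v := by
  rcases v with w | v
  · rw [addSubgroup_inl_eq_top_of_odd W n hodd w (W.kummerSelmerStructure n (Sum.inl w)),
      addSubgroup_inl_eq_top_of_odd W n hodd w (annRight _ ⊤)]
  · have hEP : localEulerPoincareCharacteristic (v.adicCompletion K) := by
      haveI : CharZero (v.adicCompletion K) := charZero_of_injective_algebraMap (algebraMap K _).injective
      exact localEulerPoincareCharacteristic_holds (v.adicCompletion K)
    exact KummerDuality.annRight_invWeilPairing_kummerSelmerStructure_inr W n e hμ hadd₁ hadd₂ hgal halt hnondeg inv v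
      (hperf v).1.1 (natCard_galoisCohomology_one_torsion_adicCompletion_eq_sq W v n hn hEP)

/-! ## §3 `[relaxed : strict]² = #H¹(K_w, E[n])` from LAGRANGIAN conditions off `w` (the count behind koly3b part XII) -/

include hnondeg in
/-- **`[H¹_𝓖 : H¹_𝓕]² = #H¹(K_w, E[n])` from Lagrangian local conditions.** `𝓕 ≤ 𝓖` Selmer structures on `E[n]`
unramified outside `S(T)`, equal off the finite place `w ∈ T`, `𝓕_w = 0`, `𝓖_w = H¹(K_w, E[n])`; the common condition
at every place `v ≠ w` is LAGRANGIAN for `inv_v(· ∪ₑ ·)` (`hmax`); `inv` a Poitou–Tate family, `e` a Weil pairing;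
`H¹_𝓕` finite. Then the index of `H¹_𝓕` in `H¹_𝓖` is EXACTLY `#H¹(K_w, E[n])^{1/2}`: the numeric self-duality
`#H¹_{𝓕*} = #H¹_𝓖`, `#H¹_{𝓖*} = #H¹_𝓕` by the Weil transport (koly3b part XII §1–§2 verbatim), then part XI's
`relIndex_sq_eq_of_selfdual`. (Part XII's `exists_forall_sub_zsmul_not_mem_ker_localization_of_lagrangian` kept only
the consequence «image not inside a line»; this is the count itself.) [cite: McCallumLMS1991, Prop. 2.1 (p. 296)]
[cite: MilneADT2006, Ch. I, Thm. 4.10] [cite: Howard2004HeegnerKolyvagin, Thm. 2.1.11] -/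
theorem relIndex_sq_eq_of_lagrangian [Finite (W.geomTorsion n)]
    (hperf : inv.IsPerfect) (hsum : inv.SumLocalTermEqZero) (hcompl : inv.SelmerComplement)
    (T : Finset (HeightOneSpectrum (𝓞 K)))
    (hS : ∀ v : HeightOneSpectrum (𝓞 K), v ∉ T → ((n : ℕ) : 𝓞 K) ∉ v.asIdeal ∧
      GaloisRep.IsUnramifiedAt v (W.torsionGaloisModule n))
    {𝓕 𝓖 : SelmerStructure (W.torsionGaloisModule n)} (h𝓕 : 𝓕.IsUnramifiedOutside (finSupport T))
    (h𝓖 : 𝓖.IsUnramifiedOutside (finSupport T)) (w : T)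
    (heq : ∀ v : Place K, v ≠ Sum.inr w.1 → 𝓕 v = 𝓖 v)
    (hstrict : 𝓕 (Sum.inr w.1) = ⊥) (hrelax : 𝓖 (Sum.inr w.1) = ⊤) (hfin : Finite 𝓕.selmerGroup)
    (hmax : ∀ v : Place K, v ≠ Sum.inr w.1 →
      annRight (invWeilPairing W n e hμ hadd₁ hadd₂ hgal inv v) (𝓕 v) = 𝓕 v) :
    (𝓕.selmerGroup.relIndex 𝓖.selmerGroup) ^ 2 =
      Nat.card (galoisCohomology ((W.torsionGaloisModule n).toLocal (Sum.inr w.1)) 1) := by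
  have hM : ∀ m : W.geomTorsion n, n • m = 0 := fun m ↦ AddSubgroup.torsionBy.nsmul m
  -- `#H¹_{𝓕*} = #H¹_𝓖`
  have hFd : Nat.card (inv.dualSelmerStructure (W.torsionGaloisModule n) 𝓕).selmerGroup =
      Nat.card 𝓖.selmerGroup := by
    refine card_dualSelmerGroup_eq_of_weilTransport W n e hμ hadd₁ hadd₂ hgal hnondeg inv 𝓕 𝓖
      (fun v b hb ↦ ?_) (fun v a ha ↦ ?_)
    · by_cases hv : v = Sum.inr w.1
      · subst hv; rw [hrelax]; exact AddSubgroup.mem_top _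
      · rw [← heq v hv]
        exact map_weilDualInv_mem_of_mem_dual_of_lagrangian W n e hμ hadd₁ hadd₂ hgal hnondeg inv v _ (hmax v hv) hb
    · by_cases hv : v = Sum.inr w.1
      · subst hv
        rw [hstrict, dualLocalCondition_bot_eq_top]
        exact AddSubgroup.mem_top _
      · rw [← heq v hv] at ha
        exact map_weilDual_mem_dual_of_lagrangian W n e hμ hadd₁ hadd₂ hgal inv v _ (hmax v hv) ha
  -- `#H¹_{𝓖*} = #H¹_𝓕`
  have hGd : Nat.card (inv.dualSelmerStructure (W.torsionGaloisModule n) 𝓖).selmerGroup =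
      Nat.card 𝓕.selmerGroup := by
    refine card_dualSelmerGroup_eq_of_weilTransport W n e hμ hadd₁ hadd₂ hgal hnondeg inv 𝓖 𝓕
      (fun v b hb ↦ ?_) (fun v a ha ↦ ?_)
    · by_cases hv : v = Sum.inr w.1
      · subst hv
        rw [hrelax, dualLocalCondition_top_eq_bot (W.torsionGaloisModule n) inv hperf hM w.1] at hb
        have hb0 : b = 0 := (AddSubgroup.mem_bot).mp hb
        subst hb0
        exact (map_zero (galoisCohomology.map ((weilDualInv W n e hμ hadd₁ hadd₂ hgal hnondeg).restrictField
          (Place.Completion (Sum.inr w.1 : Place K))) 1)).symm ▸ AddSubgroup.zero_mem _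
      · rw [← heq v hv] at hb
        exact map_weilDualInv_mem_of_mem_dual_of_lagrangian W n e hμ hadd₁ hadd₂ hgal hnondeg inv v _ (hmax v hv) hb
    · by_cases hv : v = Sum.inr w.1
      · subst hv
        rw [hstrict] at ha
        have ha0 : a = 0 := (AddSubgroup.mem_bot).mp ha
        subst ha0
        exact (map_zero (galoisCohomology.map ((weilDualIntertwining W n e hμ hadd₁ hadd₂ hgal).restrictField
          (Place.Completion (Sum.inr w.1 : Place K))) 1)).symm ▸ AddSubgroup.zero_mem _
      · rw [← heq v hv]
        exact map_weilDual_mem_dual_of_lagrangian W n e hμ hadd₁ hadd₂ hgal inv v _ (hmax v hv) ha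
  exact relIndex_sq_eq_of_selfdual T inv hperf hsum hcompl hM hS h𝓕 h𝓖 w heq hstrict hrelax hfin hFd hGd

end Lagrangian

/-! ## §4 The Kummer pair at ONE finite place `w₀`, odd prime `p`: `[relaxed : strict]² = #H¹(K_{w₀}, E[p])` -/

section KummerPair

variable (p : ℕ) [Fact p.Prime] (inv : LocalInvariants K (p ^ 1))

/-- **The jump at ONE relaxed finite place, EXACT form, odd `p`, any number field.** For `p ≠ 2`, a Poitou–Tate family `inv` (`IsPerfect`, `SumLocalTermEqZero`, `SelmerComplement` — the content of the named fact
`poitouTate_selmerStructure_duality K` = DUAL.2) and ANY finite place `w₀`: the Kummer structure made STRICT resp. RELAXED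
at `w₀` (`KummerPT.kummerStrict ∕ kummerRelaxed … {w₀}`: E's Kummer condition at every place `≠ w₀`, `0` resp. everything
at `w₀`) satisfies `[relaxed : strict]² = #H¹(K_{w₀}, E[p])`. Proof: §3 with the exceptional set `T = {v ∣ p} ∪ {bad} ∪ {w₀}`
(Kummer = unramified off it), a Weil pairing on `E[p]` (`exists_weilPairing_holds`, proved), the Lagrangian property of
E's Kummer condition at every place `≠ w₀` (§2, incl. REAL places for odd `p`) and the finiteness of
`H¹_{relaxed} = kummerOutside W p {w₀}`. At `w₀ ∣ p` with `#H¹(K_{w₀}, E[p]) = p²`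
this is the JUMP `[relaxed : strict] = p` of the three-Lagrangian switch. [cite: McCallumLMS1991, Prop. 2.1]
[cite: MilneADT2006, Ch. I, Thm. 4.10, Cor. 3.4, Lemma 6.15] [cite: PoonenRains2012, Prop. 4.11] -/
theorem relIndex_kummerStrict_kummerRelaxed_sq (hp2 : p ≠ 2) (hperf : inv.IsPerfect) (hsum : inv.SumLocalTermEqZero)
    (hcompl : inv.SelmerComplement) (w₀ : HeightOneSpectrum (𝓞 K)) :
    ((kummerStrict W (p ^ 1) {(Sum.inr w₀ : Place K)}).selmerGroup.relIndex
        (kummerRelaxed W (p ^ 1) {(Sum.inr w₀ : Place K)}).selmerGroup) ^ 2 =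
      Nat.card (galoisCohomology ((W.torsionGaloisModule ((p ^ 1 : ℕ) : ℤ)).toLocal (Sum.inr w₀ : Place K)) 1) := by
  have hp : p.Prime := Fact.out
  haveI : NeZero (p ^ 1 : ℕ) := ⟨pow_ne_zero 1 hp.ne_zero⟩
  have hp1 : IsPrimePow (p ^ 1 : ℕ) := hp.isPrimePow.pow one_ne_zero
  have hodd : Odd (p ^ 1 : ℕ) := (hp.odd_of_ne_two hp2).pow
  haveI : PerfectField K := PerfectField.ofCharZero
  haveI : ∀ v : Place K, CompactSpace (absoluteGaloisGroup (Place.Completion v)) := fun v ↦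
    absoluteGaloisGroup_compactSpace _
  haveI : Finite (W.geomTorsion ((p ^ 1 : ℕ) : ℤ)) := finite_geomTorsion_of_neZero W (p ^ 1)
  obtain ⟨e, hμ, hadd₁, hadd₂, halt, hnondeg, hgal⟩ :=
    exists_weilPairing_holds W (p ^ 1) (by rw [pow_one]; exact hp.two_le) (by exact_mod_cast pow_ne_zero 1 hp.ne_zero)
  set S' : Finset (Place K) := {(Sum.inr w₀ : Place K)} with hS'def
  -- the exceptional finite set `T'` of finite places: above `p`, bad, `w₀`
  have hp0 : (Ideal.span {((p : ℕ) : 𝓞 K)} : Ideal (𝓞 K)) ≠ 0 := by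
    rw [Ne, Ideal.zero_eq_bot, Ideal.span_singleton_eq_bot]
    exact_mod_cast hp.ne_zero
  have hpfin : {v : HeightOneSpectrum (𝓞 K) | ((p : ℕ) : 𝓞 K) ∈ v.asIdeal}.Finite :=
    (Ideal.finite_factors hp0).subset fun v hv ↦ (Ideal.dvd_span_singleton).mpr hv
  have hbadfin : {v : HeightOneSpectrum (𝓞 K) | ¬ W.HasGoodReductionAt v}.Finite := by
    have h := W.eventually_hasGoodReductionAt
    rwa [Filter.eventually_cofinite] at h
  set T' : Finset (HeightOneSpectrum (𝓞 K)) := hpfin.toFinset ∪ hbadfin.toFinset ∪ {w₀} with hT'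
  have hpT' : ∀ v : HeightOneSpectrum (𝓞 K), ((p : ℕ) : 𝓞 K) ∈ v.asIdeal → v ∈ T' := fun v hv ↦ by
    apply Finset.mem_union_left; apply Finset.mem_union_left
    exact hpfin.mem_toFinset.mpr hv
  have hbadT' : ∀ v : HeightOneSpectrum (𝓞 K), ¬ W.HasGoodReductionAt v → v ∈ T' := fun v hv ↦ by
    apply Finset.mem_union_left; apply Finset.mem_union_right
    exact hbadfin.mem_toFinset.mpr hv
  have hwT' : w₀ ∈ T' := Finset.mem_union_right _ (Finset.mem_singleton_self _)
  have houtp : ∀ v : HeightOneSpectrum (𝓞 K), v ∉ T' → ((p : ℕ) : 𝓞 K) ∉ v.asIdeal := fun v hv h ↦ hv (hpT' v h)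
  have houtgood : ∀ v : HeightOneSpectrum (𝓞 K), v ∉ T' → W.HasGoodReductionAt v := fun v hv ↦ by
    by_contra h
    exact hv (hbadT' v h)
  -- the side conditions of the Poitou–Tate engine
  have hS : ∀ v : HeightOneSpectrum (𝓞 K), v ∉ T' → (((p ^ 1 : ℕ) : ℕ) : 𝓞 K) ∉ v.asIdeal ∧
      GaloisRep.IsUnramifiedAt v (W.torsionGaloisModule ((p ^ 1 : ℕ) : ℤ)) := by
    intro v hv
    have h1 : ((p ^ 1 : ℕ) : 𝓞 K) ∉ v.asIdeal := by
      rw [pow_one]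
      exact houtp v hv
    exact ⟨h1, AcSelmer.isUnramifiedAt_torsionGaloisModule W (houtgood v hv)
      (n := ((p ^ 1 : ℕ) : ℤ)) (by rw [Int.cast_natCast]; exact h1)⟩
  have hS'T : S' ⊆ finSupport T' := by
    intro v hv
    rw [hS'def, Finset.mem_singleton] at hv
    subst hv
    exact (inr_mem_finSupport_iff T' w₀).mpr hwT'
  have hinfT : ∀ w : InfinitePlace K, (Sum.inl w : Place K) ∈ finSupport T' := fun w ↦ inl_mem_finSupport T' w
  have hpT : ∀ v : HeightOneSpectrum (𝓞 K), ((p : ℕ) : 𝓞 K) ∈ v.asIdeal → (Sum.inr v : Place K) ∈ finSupport T' :=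
    fun v hv ↦ (inr_mem_finSupport_iff T' v).mpr (hpT' v hv)
  have hbadT : ∀ v : HeightOneSpectrum (𝓞 K), ¬ W.HasGoodReductionAt v → (Sum.inr v : Place K) ∈ finSupport T' :=
    fun v hv ↦ (inr_mem_finSupport_iff T' v).mpr (hbadT' v hv)
  have hunrF : (kummerStrict W (p ^ 1) S').IsUnramifiedOutside (finSupport T') :=
    kummerStrict_isUnramifiedOutside W p 1 S' (finSupport T') hS'T hinfT hpT hbadT
  have hunrG : (kummerRelaxed W (p ^ 1) S').IsUnramifiedOutside (finSupport T') :=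
    kummerRelaxed_isUnramifiedOutside W p 1 S' (finSupport T') hS'T hinfT hpT hbadT
  have hmemS' : (Sum.inr w₀ : Place K) ∈ S' := by rw [hS'def]; exact Finset.mem_singleton_self _
  have hnotS' : ∀ v : Place K, v ≠ Sum.inr w₀ → v ∉ S' := fun v hv h ↦ by
    rw [hS'def, Finset.mem_singleton] at h
    exact hv h
  have heq : ∀ v : Place K, v ≠ Sum.inr w₀ → kummerStrict W (p ^ 1) S' v = kummerRelaxed W (p ^ 1) S' v :=
    fun v hv ↦ by
      rw [kummerStrict_of_not_mem W (p ^ 1) S' (hnotS' v hv), kummerRelaxed_of_not_mem W (p ^ 1) S' (hnotS' v hv)]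
  have hstrict : kummerStrict W (p ^ 1) S' (Sum.inr w₀) = ⊥ := kummerStrict_of_mem W (p ^ 1) S' hmemS'
  have hrelax : kummerRelaxed W (p ^ 1) S' (Sum.inr w₀) = ⊤ := kummerRelaxed_of_mem W (p ^ 1) S' hmemS'
  -- finiteness of the strict group (inside `kummerOutside W p S'`)
  have hfin : Finite (kummerStrict W (p ^ 1) S').selmerGroup := by
    have hle : (kummerStrict W (p ^ 1) S').selmerGroup ≤ (kummerRelaxed W (p ^ 1) S').selmerGroup := fun x hx ↦ by
      rw [SelmerStructure.mem_selmerGroup_iff] at hx ⊢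
      exact fun v ↦ kummerStrict_le_kummerRelaxed W (p ^ 1) S' v (hx v)
    haveI : Finite (kummerRelaxed W (p ^ 1) S').selmerGroup := by
      rw [selmerGroup_kummerRelaxed]
      exact SelmerLevelBound.finite_kummerOutside W (p ^ 1) S'
    exact Finite.of_injective (AddSubgroup.inclusion hle) (AddSubgroup.inclusion_injective hle)
  -- the Lagrangian property off `w₀` (§2)
  have hmax : ∀ v : Place K, v ≠ Sum.inr w₀ →
      annRight (invWeilPairing W (p ^ 1) e hμ hadd₁ hadd₂ hgal inv v) (kummerStrict W (p ^ 1) S' v) =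
        kummerStrict W (p ^ 1) S' v := fun v hv ↦ by
    rw [kummerStrict_of_not_mem W (p ^ 1) S' (hnotS' v hv)]
    exact annRight_kummer_eq_of_odd W (p ^ 1) e hμ hadd₁ hadd₂ hgal halt hnondeg inv hp1 hodd hperf v
  exact relIndex_sq_eq_of_lagrangian W (p ^ 1) e hμ hadd₁ hadd₂ hgal hnondeg inv hperf hsum hcompl T' hS hunrF hunrG
    ⟨w₀, hwT'⟩ heq hstrict hrelax hfin hmax

end KummerPair

end Summit.BirchSwinnertonDyer.BirchSwinnertonDyer.Theorems.AdditiveKoly.LagrangianSwitchAtP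

end
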